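import Summits.Ventures.CertifiedManyBodySolver.Observables.RungLeaves
import HarnessLib

/-!
# Ventures/CertifiedManyBodySolver — Observables/RungLeavesPairWindow.lean

HONEST FRAMING: first certified bounds on pairing observables; not a superconductivity verdict; every number certified (two
lineages + referee) or labelled float. hubbard-obs cell (D-0042), rung R2(a) / M3′-obs at `(U, n, t′) = (8, 7/8, 0)`; obs-lit seat, additive to
`Observables/RungLeaves.lean` (p405324). Zero compute; no certificate; no `sorry`; no new named leaf (the named at-range leaf stays
`M3ObsPairWindowAtRange_r21_tp0`).

**The at-range pair window at an ARBITRARY displacement class.** `RungLeaves.lean` types the pair-window target only at `r = (2,1)` (the cell's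
pre-registered K5 class). Tonight's and tomorrow's edges also certify the classes `r = (2,2)` and `r = (3,0)` (hubbard-lower EXT5-L⁺ files
`pair_dd_r22{lo,up}`, `pair_dd_r30{lo,up}`; eng-1 T2-DIRECT `classmean_Pd22`). This file adds the generic form
* `M3ObsPairWindowAt_tp0 r W` — `∃ lo hi : ℚ, lo ≤ hi ∧ hi − lo ≤ W ∧` for every torus limit `ω` of unit `(rectN (7/8) L, S^z = 0)`-sector ground states of
  `hubbardTorusTT' L 1 0 8` along `Ls → ∞`, `lo ≤ dWavePairClassMean ω r ≤ hi` (the `D₄`-class MEAN `|D₄|⁻¹ Σ_γ Re ω(Φ₀† Φ_{γr})`, RungLeaves `dWavePairClassMean`);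
* `M3ObsPairWindowAt_tp0_r21_iff` — at `r = (2,1)` it IS `M3ObsPairWindowAtRangeR21At_tp0 W` (definitional);
* `M3ObsPairWindowAt_tp0_mono`, `M3ObsPairWindowAt_tp0_intro` (from an explicit certified window `[lo, hi]` on the class mean);
* `M3ObsPairWindowAt_tp0_of_orbitRows` — two certified `D₄`-ORBIT cells (`S = univ`) on the two-point pair word at `(0, r)` and on its negation, cap
  `M3EnergyUpperRow 0 hi` with `hi ≤ u`, give the window at every `W ≥ (−q_up) − q_lo` (dictionary `m3CorrOrbitLowerRow_dWavePair_iff` /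
  `expect_d4Emb_dWavePairWord`, hubbard-obs-p1 Observables/PairWordD4Orbit.lean p402323) — the RungLeaves proof verbatim with `(2,1) ↦ r`.
Every proof offered is CONDITIONAL ON THE CLAIM NODES when fed from them (cap #354 / floor #473 / edge nodes BY NAME; obs-ref O-D(d5)).
HONEST: a window of kinematic scale (printed |P_d(r)| at |r| ≥ 2 is O(10⁻³–10⁻²), decisive half-width 5·10⁻³ — obs-lit PRINTED.md §A3/§A7); a window
neither proves nor refutes the summit.
References: D. J. Scalapino, Phys. Rep. 250 (1995) 329, §2 eq. (2.4) [Scalapino1995].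
-/

noncomputable section

namespace Summit.Ventures.CertifiedManyBodySolver.Observables

open Matrix Literature.MathematicalPhysics.QuantumLattice Literature.Probability.LatticeModels
open Literature.MathematicalPhysics.QuantumLattice.HubbardWave0 ThermodynamicLimit
open Summit.Ventures.CertifiedManyBodySolver.Certificates
open MeasureTheory Complex Filter Topology
open scoped BigOperators ComplexOrder

/-- **A certified two-sided window of width `≤ W` on the `D₄`-class-mean pair correlator `P̄_d(r)`** over the cell's thermodynamic-limit class at
`(8, 7/8, 0)`: `∃ lo hi : ℚ, lo ≤ hi ∧ hi − lo ≤ W ∧ ∀ ω of the class, lo ≤ P̄_d(r)(ω) ≤ hi`. [cite: Scalapino1995, §2 eq. (2.4)] -/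
def M3ObsPairWindowAt_tp0 (r : Site 2) (W : ℚ) : Prop :=
  ∃ lo hi : ℚ, lo ≤ hi ∧ hi - lo ≤ W ∧
    ∀ (ω : InfVolFermionState 2) (Ls : ℕ → ℕ) (ψ : ∀ L, Fock (Orb (FermionTorus 2 L))),
      Tendsto Ls atTop atTop →
      (∀ j, IsGroundStateInSector (hubbardTorusTT' (Ls j) 1 0 8) (rectN (7/8) (Ls j)) 0 (ψ (Ls j))) →
      (∀ j, star (ψ (Ls j)) ⬝ᵥ ψ (Ls j) = 1) → ω.IsTorusLimitOf ψ Ls →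
      ((lo : ℚ) : ℝ) ≤ dWavePairClassMean ω r ∧ dWavePairClassMean ω r ≤ ((hi : ℚ) : ℝ)

/-- At `r = (2,1)` the generic window IS the RungLeaves target `M3ObsPairWindowAtRangeR21At_tp0 W` (definitional). -/
theorem M3ObsPairWindowAt_tp0_r21_iff (W : ℚ) :
    M3ObsPairWindowAt_tp0 ![2, 1] W ↔ M3ObsPairWindowAtRangeR21At_tp0 W :=
  Iff.rfl

/-- … hence the NAMED leaf from the generic window at `(2,1)` with `W ≤ 1`. -/
theorem M3ObsPairWindowAtRange_r21_tp0_of_windowAt {W : ℚ} (h : M3ObsPairWindowAt_tp0 ![2, 1] W) (hW : W ≤ 1) :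
    M3ObsPairWindowAtRange_r21_tp0 :=
  M3ObsPairWindowAtRangeR21At_tp0_mono ((M3ObsPairWindowAt_tp0_r21_iff W).1 h) hW

/-- Monotone transport (a certified tighter width implies every wider target). -/
theorem M3ObsPairWindowAt_tp0_mono {r : Site 2} {W W' : ℚ} (h : M3ObsPairWindowAt_tp0 r W) (hW : W ≤ W') :
    M3ObsPairWindowAt_tp0 r W' := by
  obtain ⟨lo, hi, hle, hw, hall⟩ := h
  exact ⟨lo, hi, hle, hw.trans hW, hall⟩

/-- Introduction from an explicit certified window `[lo, hi]` on the class mean (the shape of the node files' `…_window_of` theorems). -/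
theorem M3ObsPairWindowAt_tp0_intro {r : Site 2} {lo hi W : ℚ} (hle : lo ≤ hi) (hW : hi - lo ≤ W)
    (h : ∀ (ω : InfVolFermionState 2) (Ls : ℕ → ℕ) (ψ : ∀ L, Fock (Orb (FermionTorus 2 L))),
      Tendsto Ls atTop atTop →
      (∀ j, IsGroundStateInSector (hubbardTorusTT' (Ls j) 1 0 8) (rectN (7/8) (Ls j)) 0 (ψ (Ls j))) →
      (∀ j, star (ψ (Ls j)) ⬝ᵥ ψ (Ls j) = 1) → ω.IsTorusLimitOf ψ Ls →
      ((lo : ℚ) : ℝ) ≤ dWavePairClassMean ω r ∧ dWavePairClassMean ω r ≤ ((hi : ℚ) : ℝ)) :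
    M3ObsPairWindowAt_tp0 r W :=
  ⟨lo, hi, hle, hW, h⟩

/-- **Two certified `D₄`-orbit cells at `(0, r)` ⇒ the window**: a `D₄`-orbit cell (`S = univ`) with constant `q_lo` on the two-point pair word
at `(0, r)` and one with constant `q_up` on its NEGATION, at threshold `u ≥ hi` where `M3EnergyUpperRow 0 hi` is the cap cell, give
`M3ObsPairWindowAt_tp0 r W` for every `W ≥ (−q_up) − q_lo` (dictionary: hubbard-obs-p1 `m3CorrOrbitLowerRow_dWavePair_iff` /
`expect_d4Emb_dWavePairWord`, Observables/PairWordD4Orbit.lean). [cite: Scalapino1995, §2 eq. (2.4)] -/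
theorem M3ObsPairWindowAt_tp0_of_orbitRows {r : Site 2} {u hi qlo qup W : ℚ}
    (hlo : M3CorrOrbitLowerRow 0 u qlo Finset.univ
      (pairRegion (insert (0 : Site 2) unitSteps) 0 ∪ pairRegion (insert (0 : Site 2) unitSteps) r)
      (fermionEmbed (PolySite.incl Finset.subset_union_left) (localPairAt (insert (0 : Site 2) unitSteps) dWaveFormFactor 0)ᴴ *
        fermionEmbed (PolySite.incl Finset.subset_union_right) (localPairAt (insert (0 : Site 2) unitSteps) dWaveFormFactor r)))
    (hup : M3CorrOrbitLowerRow 0 u qup Finset.univ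
      (pairRegion (insert (0 : Site 2) unitSteps) 0 ∪ pairRegion (insert (0 : Site 2) unitSteps) r)
      (-(fermionEmbed (PolySite.incl Finset.subset_union_left) (localPairAt (insert (0 : Site 2) unitSteps) dWaveFormFactor 0)ᴴ *
        fermionEmbed (PolySite.incl Finset.subset_union_right) (localPairAt (insert (0 : Site 2) unitSteps) dWaveFormFactor r))))
    (hE : M3EnergyUpperRow 0 hi) (hhi : hi ≤ u) (hq : qlo ≤ -qup) (hW : -qup - qlo ≤ W) :
    M3ObsPairWindowAt_tp0 r W := by
  refine ⟨qlo, -qup, hq, by linarith, fun ω Ls ψ h1 h2 h3 h4 => ?_⟩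
  have hu : energyDensityTT' 1 0 8 (7 / 8) ≤ ((u : ℚ) : ℝ) :=
    (show energyDensityTT' 1 0 8 (7 / 8) ≤ ((hi : ℚ) : ℝ) from hE).trans (by exact_mod_cast hhi)
  have hl := (m3CorrOrbitLowerRow_dWavePair_iff 0 u qlo Finset.univ r).1 hlo ω Ls ψ h1 h2 h3 h4 hu
  have hu' := hup ω Ls ψ h1 h2 h3 h4 hu
  have hneg : ∀ γ : DihedralGroup 4,
      (ω.expect (d4ShiftSet γ 0 (pairRegion (insert (0 : Site 2) unitSteps) 0 ∪ pairRegion (insert (0 : Site 2) unitSteps) r))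
        (fermionEmbed (PolySite.d4Emb γ 0 (pairRegion (insert (0 : Site 2) unitSteps) 0 ∪ pairRegion (insert (0 : Site 2) unitSteps) r))
          (-(fermionEmbed (PolySite.incl Finset.subset_union_left) (localPairAt (insert (0 : Site 2) unitSteps) dWaveFormFactor 0)ᴴ *
            fermionEmbed (PolySite.incl Finset.subset_union_right) (localPairAt (insert (0 : Site 2) unitSteps) dWaveFormFactor r))))).re =
      -(ω.dWavePairCorr 0 (d4Vec γ r)).re := fun γ => by
    rw [map_neg, map_neg, Complex.neg_re, expect_d4Emb_dWavePairWord, add_zero, add_zero, (d4Vec_eq_zero_iff γ 0).2 rfl]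
  simp only [hneg, Finset.sum_neg_distrib, mul_neg] at hu'
  refine ⟨?_, ?_⟩
  · simpa [dWavePairClassMean] using hl
  · have : dWavePairClassMean ω r ≤ -((qup : ℚ) : ℝ) := by
      unfold dWavePairClassMean; linarith
    simpa using this

end Summit.Ventures.CertifiedManyBodySolver.Observables

end
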